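import Literature.AlgebraicGeometry.Frobenioids.PadicKummerSetting
import HarnessLib

/-!
# Frobenioids II, Theorem 2.4: isomorphisms of the Definition 2.2 data ("induced by `Ψ`")

Mochizuki, *The geometry of Frobenioids II*, Kyushu J. Math. **62** (2008) 401–460, §2, Theorem 2.4
pp. 19–20 [cite: MochizukiFrdII2008, Thm 2.4 (i) p.19]. Companion to `PadicKummerSetting.lean`
(abc-iut-L1-t7), ADDITIVE.

**The printed hypothesis.** Theorem 2.4 starts from an equivalence `Ψ : C₁ ⥲ C₂` of `pᵢ`-adic
Frobenioids which "[cf. Theorem 1.2, (i); Example 1.3, (i); [FrdI], Theorem 3.4, (v)] necessarily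
induces a 1-compatible equivalence `Ψ_Base : D₁ ⥲ D₂`, hence an outer isomorphism of topological
groups `Π₁ ⥲ Π₂` [cf. [SemiAnbd], Proposition 3.2; Theorem A.4] that lies over an outer
isomorphism `G₁ ⥲ G₂` [cf. [AbsAnab], Theorem 1.1.1, (ii)]" mapping `H₁` onto `H₂`, with
`A₂ = Ψ(A₁)`; and the proof of (i) (p. 20) uses "the fact that `Ψ` preserves `O^⊳(−)`". The net
INPUT to the Kummer-theoretic part of the proof is therefore an isomorphism of the Definition 2.2
data of the two objects: `Aut_{C₁}(A₁) ⥲ Aut_{C₂}(A₂)`, `O^□(A₁) ⥲ O^□(A₂)`,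
`Aut_{E₁}((A₁)_{E₁}) ⥲ Aut_{E₂}((A₂)_{E₂})`, `G₁ ⥲ G₂` (topological), compatible with the
restriction maps, the actions and the outer surjections, carrying `H₁` to `H₂` and "`(A₁)_{D₁}`
Galois" to "`(A₂)_{D₂}` Galois". This file TYPES that notion (`Def22Context.Iso`) over the
interface `PadicKummerSetting.Def22Context`, with `refl`/`symm`/`trans` and the isomorphisms it
induces on the DERIVED groups of Def. 2.2 (i): `H_A` (`isoHA`), `G_A` (`isoGA`), `H` (`isoH`,
topological), each with its compatibility (PROVED). The cohomological comparison isomorphisms of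
Theorem 2.4 (i) (`H¹`, `F_N`) and the compatibilities with the Kummer / reciprocity maps are the
DISCHARGE side (abc-iut-L1-d4, `PadicKummerSettingProofs.lean`) and are not constructed here; the
derivation of such an `Iso` from an actual `Ψ` is the category-theoretic content ([FrdI] Thm. 3.4
(v), [SemiAnbd] Prop. 3.2, [AbsAnab] Thm. 1.1.1 (ii)) at the `p`-adic-Frobenioid binding. Nothing
here concerns [IUTchIII]. Universe `0` as in `PadicKummerSetting.lean`.
-/

namespace Literature.AlgebraicGeometry.Frobenioids

namespace PadicKummer

namespace Def22Context

/-- **Theorem 2.4, hypothesis** (FrdII pp. 19–20): an isomorphism of the Definition 2.2 data of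
two objects `A₁`, `A₂` — what `Ψ : C₁ ⥲ C₂` with `Ψ(A₁) = A₂`, `Ψ_Base`, the outer isomorphism
`G₁ ⥲ G₂` over it "[assumed to map] `H₁` onto `H₂`", and "`Ψ` preserves `O^⊳(−)`" (p. 20) induce:
group isomorphisms `Aut_{C₁}(A₁) ⥲ Aut_{C₂}(A₂)` (`isoC`), `O^□(A₁) ⥲ O^□(A₂)` (`isoO`),
`Aut_{E₁}((A₁)_{E₁}) ⥲ Aut_{E₂}((A₂)_{E₂})` (`isoE`), a topological isomorphism `G₁ ⥲ G₂`
(`isoG`, a representative of the outer isomorphism), compatible with `Aut_C(A) → Aut_E(A_E)`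
(`res_isoC`), with the actions on `O^□` (`isoO_smul`), with the outer surjections
`G ↠ Aut_E(A_E)` (`outer_isoG`), carrying `H₁` onto `H₂` (`map_H`) and "`A_D` Galois" to
"`A_D` Galois" (`isGalois_iff`). [cite: MochizukiFrdII2008, Thm 2.4 (i) p.19] -/
structure Iso (X₁ X₂ : Def22Context) : Type where
  /-- `Aut_{C₁}(A₁) ⥲ Aut_{C₂}(A₂)` -/
  isoC : X₁.AutC ≃* X₂.AutC
  /-- `O^□(A₁) ⥲ O^□(A₂)` ("`Ψ` preserves `O^⊳(−)`") -/
  isoO : X₁.O ≃* X₂.O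
  /-- `Aut_{E₁}((A₁)_{E₁}) ⥲ Aut_{E₂}((A₂)_{E₂})` -/
  isoE : X₁.AutE ≃* X₂.AutE
  /-- the outer isomorphism of topological groups `G₁ ⥲ G₂` (a representative) -/
  isoG : X₁.G ≃ₜ* X₂.G
  /-- compatibility with `Aut_C(A) → Aut_E(A_E)` -/
  res_isoC : ∀ α : X₁.AutC, X₂.res (isoC α) = isoE (X₁.res α)
  /-- equivariance of `O^□(A₁) ⥲ O^□(A₂)` for the actions of `Aut_E(A_E)` -/
  isoO_smul : ∀ (τ : X₁.AutE) (x : X₁.O), isoO (τ • x) = isoE τ • isoO x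
  /-- compatibility with the outer surjections `G ↠ Aut_E(A_E)` -/
  outer_isoG : ∀ g : X₁.G, X₂.outer (isoG g) = isoE (X₁.outer g)
  /-- `G₁ ⥲ G₂` maps `H₁` onto `H₂` -/
  map_H : X₁.H.map isoG.toMulEquiv.toMonoidHom = X₂.H
  /-- `(A₁)_{D₁}` is Galois iff `(A₂)_{D₂}` is -/
  isGalois_iff : X₁.isGalois ↔ X₂.isGalois

namespace Iso

variable {X₁ X₂ X₃ : Def22Context}

/-- Equivariance of `O^□(A₁) ⥲ O^□(A₂)` for the conjugation actions of `Aut_C(A)` (which act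
through `Aut_C(A) → Aut_E(A_E)`, Def. 2.2 (i)). [cite: MochizukiFrdII2008, Thm 2.4 (i) p.19] -/
theorem isoO_smulC (e : Iso X₁ X₂) (α : X₁.AutC) (x : X₁.O) :
    e.isoO (α • x) = e.isoC α • e.isoO x := by
  rw [← X₁.res_smul, e.isoO_smul, ← e.res_isoC, X₂.res_smul]

/-- Membership transport for `H`: `isoG g ∈ H₂ ↔ g ∈ H₁`. [cite: MochizukiFrdII2008, Thm 2.4 (i) p.19] -/
theorem isoG_mem_H_iff (e : Iso X₁ X₂) (g : X₁.G) : e.isoG g ∈ X₂.H ↔ g ∈ X₁.H := by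
  rw [← e.map_H]
  constructor
  · rintro ⟨g', hg', h⟩
    rwa [← e.isoG.injective h]
  · exact fun hg => ⟨g, hg, rfl⟩

/-- `isoG⁻¹` maps `H₂` into `H₁`. [cite: MochizukiFrdII2008, Thm 2.4 (i) p.19] -/
theorem isoG_symm_mem_H (e : Iso X₁ X₂) {g : X₂.G} (hg : g ∈ X₂.H) : e.isoG.symm g ∈ X₁.H := by
  rw [← e.isoG_mem_H_iff, e.isoG.apply_symm_apply]
  exact hg

/-! ### `refl`, `symm`, `trans` -/

/-- The identity (`Ψ = 𝟭`). [cite: MochizukiFrdII2008, Thm 2.4 (i) p.19] -/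
def refl (X : Def22Context) : Iso X X where
  isoC := MulEquiv.refl _
  isoO := MulEquiv.refl _
  isoE := MulEquiv.refl _
  isoG := ContinuousMulEquiv.refl _
  res_isoC _ := rfl
  isoO_smul _ _ := rfl
  outer_isoG _ := rfl
  map_H := Subgroup.ext fun g =>
    ⟨by rintro ⟨g', hg', rfl⟩; exact hg', fun hg => ⟨g, hg, rfl⟩⟩
  isGalois_iff := Iff.rfl

/-- The inverse (`Ψ⁻¹`). [cite: MochizukiFrdII2008, Thm 2.4 (i) p.19] -/
def symm (e : Iso X₁ X₂) : Iso X₂ X₁ where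
  isoC := e.isoC.symm
  isoO := e.isoO.symm
  isoE := e.isoE.symm
  isoG := e.isoG.symm
  res_isoC β := by
    apply e.isoE.injective
    rw [MulEquiv.apply_symm_apply, ← e.res_isoC, MulEquiv.apply_symm_apply]
  isoO_smul τ y := by
    apply e.isoO.injective
    rw [MulEquiv.apply_symm_apply, e.isoO_smul, MulEquiv.apply_symm_apply,
      MulEquiv.apply_symm_apply]
  outer_isoG g := by
    apply e.isoE.injective
    rw [MulEquiv.apply_symm_apply, ← e.outer_isoG]
    exact congrArg X₂.outer (e.isoG.apply_symm_apply g)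
  map_H := Subgroup.ext fun g => by
    rw [Subgroup.mem_map]
    constructor
    · rintro ⟨g', hg', rfl⟩
      exact e.isoG_symm_mem_H hg'
    · intro hg
      exact ⟨e.isoG g, (e.isoG_mem_H_iff g).mpr hg, e.isoG.symm_apply_apply g⟩
  isGalois_iff := e.isGalois_iff.symm

/-- Composition (`Ψ' ∘ Ψ`). [cite: MochizukiFrdII2008, Thm 2.4 (i) p.19] -/
def trans (e : Iso X₁ X₂) (e' : Iso X₂ X₃) : Iso X₁ X₃ where
  isoC := e.isoC.trans e'.isoC
  isoO := e.isoO.trans e'.isoO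
  isoE := e.isoE.trans e'.isoE
  isoG := e.isoG.trans e'.isoG
  res_isoC α := by
    change X₃.res (e'.isoC (e.isoC α)) = e'.isoE (e.isoE (X₁.res α))
    rw [e'.res_isoC, e.res_isoC]
  isoO_smul τ x := by
    change e'.isoO (e.isoO (τ • x)) = e'.isoE (e.isoE τ) • e'.isoO (e.isoO x)
    rw [e.isoO_smul, e'.isoO_smul]
  outer_isoG g := by
    change X₃.outer (e'.isoG (e.isoG g)) = e'.isoE (e.isoE (X₁.outer g))
    rw [e'.outer_isoG, e.outer_isoG]
  map_H := Subgroup.ext fun g => by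
    rw [Subgroup.mem_map]
    constructor
    · rintro ⟨g₁, hg₁, rfl⟩
      exact (e'.isoG_mem_H_iff _).mpr ((e.isoG_mem_H_iff _).mpr hg₁)
    · intro hg
      refine ⟨e.isoG.symm (e'.isoG.symm g), e.isoG_symm_mem_H (e'.isoG_symm_mem_H hg), ?_⟩
      change e'.isoG (e.isoG (e.isoG.symm (e'.isoG.symm g))) = g
      rw [e.isoG.apply_symm_apply, e'.isoG.apply_symm_apply]
  isGalois_iff := e.isGalois_iff.trans e'.isGalois_iff

/-! ### The induced isomorphisms on `H_A`, `G_A`, `H` (Definition 2.2 (i)) -/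

/-- `isoE` carries `(H₁)_{A₁} = Im(H₁)` onto `(H₂)_{A₂} = Im(H₂)`.
[cite: MochizukiFrdII2008, Thm 2.4 (i) p.19] -/
theorem map_HA (e : Iso X₁ X₂) : X₁.HA.map e.isoE.toMonoidHom = X₂.HA := by
  apply Subgroup.ext
  intro τ
  simp only [HA, Subgroup.mem_map]
  constructor
  · rintro ⟨_, ⟨h, hh, rfl⟩, rfl⟩
    exact ⟨e.isoG h, (e.isoG_mem_H_iff h).mpr hh, e.outer_isoG h⟩
  · rintro ⟨h₂, hh₂, rfl⟩
    refine ⟨X₁.outer (e.isoG.symm h₂), ⟨e.isoG.symm h₂, e.isoG_symm_mem_H hh₂, rfl⟩, ?_⟩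
    change e.isoE (X₁.outer (e.isoG.symm h₂)) = X₂.outer h₂
    rw [← e.outer_isoG, e.isoG.apply_symm_apply]

/-- **Theorem 2.4 (i)**, "`(H₁)_{A₁} ⥲ (H₂)_{A₂}`": the isomorphism induced on `H_A`.
[cite: MochizukiFrdII2008, Thm 2.4 (i) p.19] -/
noncomputable def isoHA (e : Iso X₁ X₂) : X₁.HA ≃* X₂.HA :=
  (e.isoE.subgroupMap X₁.HA).trans (MulEquiv.subgroupCongr e.map_HA)

/-- `isoHA` is `isoE` on elements. [cite: MochizukiFrdII2008, Thm 2.4 (i) p.19] -/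
@[simp] theorem coe_isoHA (e : Iso X₁ X₂) (h : X₁.HA) : ((e.isoHA h : X₂.HA) : X₂.AutE) = e.isoE h :=
  rfl

/-- Equivariance of `O^□(A₁) ⥲ O^□(A₂)` along `isoHA` (the shape of `Thm24Data.equivariant`).
[cite: MochizukiFrdII2008, Thm 2.4 (i) p.19] -/
theorem isoO_smul_HA (e : Iso X₁ X₂) (h : X₁.HA) (x : X₁.O) :
    e.isoO ((h : X₁.AutE) • x) = (e.isoHA h : X₂.AutE) • e.isoO x := by
  rw [coe_isoHA, e.isoO_smul]

/-- `isoC` carries `Ker(Aut_{C₁}(A₁) → Aut_{E₁})` onto `Ker(Aut_{C₂}(A₂) → Aut_{E₂})`.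
[cite: MochizukiFrdII2008, Thm 2.4 (i) p.19] -/
theorem map_ker_res (e : Iso X₁ X₂) : X₁.res.ker.map e.isoC.toMonoidHom = X₂.res.ker := by
  apply Subgroup.ext
  intro β
  rw [Subgroup.mem_map, MonoidHom.mem_ker]
  constructor
  · rintro ⟨α, hα, rfl⟩
    rw [MonoidHom.mem_ker] at hα
    change X₂.res (e.isoC α) = 1
    rw [e.res_isoC, hα, map_one]
  · intro hβ
    refine ⟨e.isoC.symm β, ?_, e.isoC.apply_symm_apply β⟩
    rw [MonoidHom.mem_ker]
    apply e.isoE.injective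
    rw [← e.res_isoC, MulEquiv.apply_symm_apply, hβ, map_one]

/-- **Theorem 2.4 (i)**, "`(G₁)_{A₁} ⥲ (G₂)_{A₂}`": the isomorphism induced on
`G_A = Aut_C(A)/Ker(Aut_C(A) → Aut_E(A_E))`. [cite: MochizukiFrdII2008, Thm 2.4 (i) p.19] -/
noncomputable def isoGA (e : Iso X₁ X₂) : X₁.GA ≃* X₂.GA :=
  QuotientGroup.congr X₁.res.ker X₂.res.ker e.isoC e.map_ker_res

/-- `isoGA` on classes. [cite: MochizukiFrdII2008, Thm 2.4 (i) p.19] -/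
@[simp] theorem isoGA_mk (e : Iso X₁ X₂) (α : X₁.AutC) :
    e.isoGA (QuotientGroup.mk α) = QuotientGroup.mk (e.isoC α) := rfl

/-- `isoGA` is compatible with the inclusions `G_A ↪ Aut_E(A_E)`.
[cite: MochizukiFrdII2008, Thm 2.4 (i) p.19] -/
theorem gaToAutE_isoGA (e : Iso X₁ X₂) (a : X₁.GA) :
    X₂.gaToAutE (e.isoGA a) = e.isoE (X₁.gaToAutE a) := by
  induction a using QuotientGroup.induction_on with
  | H α => exact e.res_isoC α

/-- The topological isomorphism `H₁ ⥲ H₂` induced by `G₁ ⥲ G₂`.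
[cite: MochizukiFrdII2008, Thm 2.4 (i) p.19] -/
noncomputable def isoH (e : Iso X₁ X₂) : X₁.H ≃ₜ* X₂.H where
  toFun h := ⟨e.isoG h, (e.isoG_mem_H_iff _).mpr h.2⟩
  invFun h := ⟨e.isoG.symm h, e.isoG_symm_mem_H h.2⟩
  left_inv _ := Subtype.ext (e.isoG.symm_apply_apply _)
  right_inv _ := Subtype.ext (e.isoG.apply_symm_apply _)
  map_mul' _ _ := Subtype.ext (map_mul e.isoG _ _)
  continuous_toFun := Continuous.subtype_mk (e.isoG.continuous.comp continuous_subtype_val) _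
  continuous_invFun :=
    Continuous.subtype_mk (e.isoG.symm.continuous.comp continuous_subtype_val) _

/-- `isoH` is `isoG` on elements. [cite: MochizukiFrdII2008, Thm 2.4 (i) p.19] -/
@[simp] theorem coe_isoH (e : Iso X₁ X₂) (h : X₁.H) : ((e.isoH h : X₂.H) : X₂.G) = e.isoG h := rfl

/-- The square `H₁ ↠ (H₁)_{A₁}`, `H₂ ↠ (H₂)_{A₂}` commutes with `isoH`, `isoHA`.
[cite: MochizukiFrdII2008, Thm 2.4 (i) p.19] -/
theorem toHA_isoH (e : Iso X₁ X₂) (h : X₁.H) : X₂.toHA (e.isoH h) = e.isoHA (X₁.toHA h) :=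
  Subtype.ext (e.outer_isoG h)

/-- The same square for the continuous homomorphisms `qHA`.
[cite: MochizukiFrdII2008, Thm 2.4 (i) p.19] -/
theorem qHA_isoH (e : Iso X₁ X₂) (h : X₁.H) :
    ((X₂.qHA (e.isoH h) : X₂.HA) : X₂.AutE) = e.isoE (X₁.qHA h) :=
  e.outer_isoG h

end Iso

end Def22Context

end PadicKummer

end Literature.AlgebraicGeometry.Frobenioids
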